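import Summits.Schanuel.Schanuel.Theorems.ZilberEacRealHyperplaneFastDefs
import HarnessLib

/-!
# THEOREM R⁺⁺: the MIXED fast/slow regime over real hyperplane bases (new members of EC(3,2) solved)

Zilber's Exponential-Algebraic Closedness, case ladder (host summit Schanuel, cell `pub-schanuel`,
seat 2, gen 8).  THEOREM R (`exists_expPoint_realHyperplane`, gen 2) and R⁺
(`exists_expPoint_realHyperplane_slow`, gen 7) solve `e^{xⱼ} = Aⱼ(x) + e^{ℓ(x)} Fⱼ(e^{ℓ(x)})`
(`j ≤ s`, `ℓ = Σ rᵢ xᵢ + c`, `rᵢ ∈ ℝ`) near the lattice centres when EVERY fibre is slow: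
`λ + max(λ,0) deg Fⱼ < deg Aⱼ`, `λ = Σ rⱼ deg Aⱼ`.  Here the distinguished fibre `j = 0` is FAST:
following the one-variable device of `ZilberEacMovingLineFast`, substitute `z₀ = e ℓ(x)`
(`e = 1 + deg F₀`), `zⱼ = xⱼ` (`j ≥ 1`), i.e. `x = ψ(z)` with `x₀ = (z₀/e - Σ_{i≥1} rᵢ zᵢ - c)/r₀`
(`fastBack`).  With `u = e^{z₀/e} = e^{ℓ(x)}` and `u F₀(u) = c₀ e^{z₀} + u F̃₀(u)` the system becomes
`e^{z₀} = Â₀(z) + (e^{x₀(z)} - u F̃₀(u))/c₀`, `e^{zⱼ} = Âⱼ(z) + u Fⱼ(u)` (`j ≥ 1`),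
`Â = fastData r c A F` (`Â₀ = -A₀∘ψ/c₀`, `Âⱼ = Aⱼ∘ψ`), and near the lattice centres of the `z`-system
(`Re zⱼ = d̂ⱼ log m + O(1)`, `d̂ⱼ = deg Âⱼ`) every perturbation is RELATIVELY small provided
  (i) `ν := (d̂₀/e - Σ_{i≥1} rᵢ d̂ᵢ)/r₀ < d̂₀` (`|e^{x₀}| ≍ m^{ν}`), and
  (ii) `d̂₀ (1 + deg Fⱼ) < e d̂ⱼ` for `j ≥ 1` with `Fⱼ ≠ 0` (`|u Fⱼ(u)| ≍ m^{d̂₀(1+deg Fⱼ)/e}`).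

* `exists_expPoint_realHyperplane_mixed` — THEOREM R⁺⁺: under (i), (ii), `d̂₀ ≥ 1`, `F₀ ≠ 0`,
  `(Âⱼ)_top(2πiq) ≠ 0`, for all large `m` there is `z` within `1/2` of the `m`-th lattice centre such
  that `x = ψ(z)` solves the ORIGINAL system.  For `s = 0` this is the fast regime of
  `ZilberEacMovingLineFast`; for `s = 1` these are NEW members of the open cell `EC(3,2)`
  (3-folds `{x₃ = r₀x₁ + r₁x₂ + c, yⱼ = Aⱼ(x) + y₃Fⱼ(y₃)}` outside THEOREMS R/R⁺), e.g.
  `e^{z} = z + e^{2(√2 z + √3 w)}`, `e^{w} = w + e^{√2 z + √3 w}` (`ZilberEacRealHyperplaneFastExamples`).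

HONEST FRAMING: a modest new existence theorem for explicit members of the OPEN cell `ECCell 3 2`;
the all-fast and "explosion" balances, Zariski density of these 3-folds, and `EC(3,2)` itself remain
OPEN; NOT Schanuel's conjecture; EAC ⇏ SC.
-/

noncomputable section

open Complex MvPolynomial Filter Topology Metric
open Literature.NumberTheory.Transcendental Literature.ModelTheory.Zilber

set_option linter.dupNamespace false

namespace Summit.Schanuel.Schanuel.Theorems

section Mixed

variable {s : ℕ}

/-- Real part of the eliminated coordinate: `Re x₀(z) = (Re z₀/e - Σ_{i≥1} rᵢ Re zᵢ - Re c)/r₀`.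
[folklore] -/
theorem re_fastBack_zero (r : Fin (s + 1) → ℝ) (c : ℂ) (e : ℕ) (z : Fin (s + 1) → ℂ) :
    (fastBack r c e z 0).re =
      ((z 0).re / e - ∑ i : Fin s, r i.succ * (z i.succ).re - c.re) / r 0 := by
  rw [fastBack_zero, Complex.div_ofReal_re, Complex.sub_re, Complex.sub_re, Complex.div_natCast_re,
    Complex.re_sum]
  simp only [Complex.re_ofReal_mul]

/-- **THEOREM R⁺⁺ (mixed fast/slow regime over a real hyperplane).**  See the module docstring:
`r ∈ ℝ^{s+1}` with `r₀ ≠ 0`, `c ∈ ℂ`, `q ∈ ℤ^{s+1}`, `Aⱼ ∈ ℂ[x₀..x_s]`, `Fⱼ ∈ ℂ[u]` with `F₀ ≠ 0`;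
`Â = fastData r c A F` with non-vanishing leading forms at `2πi q`, `d̂₀ ≥ 1`, and the exponent
conditions (i) `(d̂₀/e - Σ_{i≥1} rᵢ d̂ᵢ)/r₀ < d̂₀`, (ii) `d̂₀ (1 + deg Fⱼ) < e d̂ⱼ` (`j ≥ 1`, `Fⱼ ≠ 0`),
`e = 1 + deg F₀`.  Then for all large `m` some `z` within `1/2` of the lattice centre
`(2πi m qⱼ + log Âⱼ(2πi m q))ⱼ` gives a solution `x = fastBack r c e z` of
`e^{xⱼ} = Aⱼ(x) + e^{ℓ(x)} Fⱼ(e^{ℓ(x)})` for ALL `j ≤ s`, `ℓ(x) = Σ rᵢ xᵢ + c`. (new)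
[cite: MantovaMasser2023, §1 p.5 (the open case dim π(V) = 2 in ℂ³×ℂˣ³)] -/
theorem exists_expPoint_realHyperplane_mixed (r : Fin (s + 1) → ℝ) (hr : r 0 ≠ 0) (c : ℂ)
    (q : Fin (s + 1) → ℤ) (A : Fin (s + 1) → MvPolynomial (Fin (s + 1)) ℂ)
    (F : Fin (s + 1) → Polynomial ℂ) (hF : F 0 ≠ 0)
    (hA : ∀ j, eval (fun i => 2 * Real.pi * I * (q i : ℂ))
      (homogeneousComponent (fastData r c A F j).totalDegree (fastData r c A F j)) ≠ 0)
    (hd0 : 0 < (fastData r c A F 0).totalDegree)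
    (hν : (((fastData r c A F 0).totalDegree : ℝ) / ((F 0).natDegree + 1) -
        ∑ i : Fin s, r i.succ * (fastData r c A F i.succ).totalDegree) / r 0 <
      (fastData r c A F 0).totalDegree)
    (hfast : ∀ i : Fin s, F i.succ ≠ 0 →
      ((fastData r c A F 0).totalDegree : ℝ) * ((F i.succ).natDegree + 1) <
        ((F 0).natDegree + 1) * (fastData r c A F i.succ).totalDegree) :
    ∀ᶠ m : ℕ in atTop, ∃ z : Fin (s + 1) → ℂ,
      ‖z - fun i => (m : ℂ) * (2 * Real.pi * I * (q i : ℂ)) +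
          log (eval (fun k => (m : ℂ) * (2 * Real.pi * I * (q k : ℂ))) (fastData r c A F i))‖ ≤ 1 / 2 ∧
      ∀ j, exp (fastBack r c ((F 0).natDegree + 1) z j) =
        eval (fastBack r c ((F 0).natDegree + 1) z) (A j) +
          exp (ell r c (fastBack r c ((F 0).natDegree + 1) z)) *
            (F j).eval (exp (ell r c (fastBack r c ((F 0).natDegree + 1) z))) := by
  classical
  -- ### names
  set e : ℕ := (F 0).natDegree + 1 with he
  have hepos : (0 : ℝ) < e := by positivity
  have he1 : (1 : ℝ) ≤ e := by rw [he]; exact_mod_cast Nat.succ_le_succ (Nat.zero_le _)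
  set Ah : Fin (s + 1) → MvPolynomial (Fin (s + 1)) ℂ := fastData r c A F with hAh
  set d : Fin (s + 1) → ℕ := fun j => (Ah j).totalDegree with hd
  set c₀ : ℂ := (F 0).leadingCoeff with hc₀def
  have hc0 : c₀ ≠ 0 := Polynomial.leadingCoeff_ne_zero.2 hF
  set Fe : Polynomial ℂ := (F 0).eraseLead with hFe
  set v : Fin (s + 1) → ℂ := fun j => 2 * Real.pi * I * (q j : ℂ) with hv
  set x₀ : ℕ → Fin (s + 1) → ℂ := fun m i => (m : ℂ) * v i + log (eval (fun k => (m : ℂ) * v k) (Ah i))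
    with hx₀
  set ν : ℝ := (((d 0 : ℝ) / e - ∑ i : Fin s, r i.succ * (d i.succ : ℝ))) / r 0 with hνdef
  have hνlt : ν < d 0 := by
    have : ν = (((d 0 : ℝ)) / ((F 0).natDegree + 1) - ∑ i : Fin s, r i.succ * (d i.succ : ℝ)) / r 0 := by
      rw [hνdef, he]; push_cast; rfl
    rw [this]; exact hν
  -- ### the perturbations
  set P : Fin (s + 1) → (Fin (s + 1) → ℂ) → ℂ :=
    Fin.cons (fun z => c₀⁻¹ * (exp (fastBack r c e z 0) - exp (z 0 / (e : ℂ)) * Fe.eval (exp (z 0 / (e : ℂ)))))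
      (fun i z => exp (z 0 / (e : ℂ)) * (F i.succ).eval (exp (z 0 / (e : ℂ)))) with hP
  have hP0 : ∀ z : Fin (s + 1) → ℂ, P 0 z = c₀⁻¹ * (exp (fastBack r c e z 0) -
      exp (z 0 / (e : ℂ)) * Fe.eval (exp (z 0 / (e : ℂ)))) := fun z => by
    simp only [hP, Fin.cons_zero]
  have hPs : ∀ (i : Fin s) (z : Fin (s + 1) → ℂ),
      P i.succ z = exp (z 0 / (e : ℂ)) * (F i.succ).eval (exp (z 0 / (e : ℂ))) :=
    fun i z => by simp only [hP, Fin.cons_succ]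
  have h0diff : Differentiable ℂ (fun z : Fin (s + 1) → ℂ => z 0) := differentiable_apply 0
  have hudiff : Differentiable ℂ (fun z : Fin (s + 1) → ℂ => exp (z 0 / (e : ℂ))) := by
    simp_rw [div_eq_mul_inv]; exact (h0diff.mul_const _).cexp
  have hbackdiff : Differentiable ℂ (fun z : Fin (s + 1) → ℂ => fastBack r c e z 0) := by
    simp only [fastBack_zero]
    simp_rw [div_eq_mul_inv]
    refine ((((h0diff.mul_const _).sub ?_).sub_const _).mul_const _)
    exact Differentiable.fun_sum fun i _ => (differentiable_apply _).const_mul _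
  have hPdiff : ∀ j, Differentiable ℂ (P j) := by
    intro j
    refine Fin.cases ?_ (fun i => ?_) j
    · simp only [hP, Fin.cons_zero]
      exact (hbackdiff.cexp.sub (hudiff.mul (Fe.differentiable.comp hudiff))).const_mul _
    · simp only [hP, Fin.cons_succ]
      exact hudiff.mul ((F i.succ).differentiable.comp hudiff)
  -- ### two-sided control of the real parts on the unit polydiscs around the centres
  set a : Fin (s + 1) → ℝ := fun j => ‖eval v (homogeneousComponent (Ah j).totalDegree (Ah j))‖ with ha
  have ha0 : ∀ j, 0 < a j := fun j => norm_pos_iff.mpr (hA j)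
  have hctrl := fun j => latticeValue_control (Ah j) v (hA j) one_pos
  choose ρ hρ t₀ ht₀ hc using hctrl
  set Cb : ℝ := 1 + ∑ j, (|Real.log (a j / 2)| + |Real.log (2 * a j)|) with hCbdef
  have hsum0 : 0 ≤ ∑ j, (|Real.log (a j / 2)| + |Real.log (2 * a j)|) :=
    Finset.sum_nonneg fun j _ => by positivity
  have hCb0 : 0 ≤ Cb := by rw [hCbdef]; positivity
  have hCj : ∀ j, |Real.log (a j / 2)| + |Real.log (2 * a j)| ≤
      ∑ i, (|Real.log (a i / 2)| + |Real.log (2 * a i)|) := fun j =>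
    Finset.single_le_sum (f := fun i => |Real.log (a i / 2)| + |Real.log (2 * a i)|)
      (fun i _ => by positivity) (Finset.mem_univ j)
  have hbox : ∀ᶠ m : ℕ in atTop, ∀ ξ : Fin (s + 1) → ℂ, ‖ξ‖ ≤ 1 →
      ∀ j, |(x₀ m j + ξ j).re - d j * Real.log m| ≤ Cb := by
    filter_upwards [eventually_all.2 fun j => tendsto_natCast_atTop_atTop.eventually_ge_atTop (t₀ j)]
      with m hm ξ hξ j
    obtain ⟨-, hlow, hupp, -⟩ := hc j m (hm j)
    have hm1 : (1 : ℝ) ≤ m := (ht₀ j).trans (hm j)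
    obtain ⟨h1, h2, -⟩ := log_latticeValue_bounds (by have := ha0 j; positivity) hm1 hlow hupp
    have hre : (x₀ m j + ξ j).re = Real.log ‖eval (fun k => (m : ℂ) * v k) (Ah j)‖ + (ξ j).re := by
      simp only [hx₀, Complex.add_re, Complex.log_re, Complex.mul_re, Complex.natCast_re,
        Complex.natCast_im, zero_mul, sub_zero]
      have : (v j).re = 0 := by simp [hv]
      rw [this, mul_zero, zero_add]
    have h3 : |(ξ j).re| ≤ 1 := (Complex.abs_re_le_norm _).trans ((norm_le_pi_norm ξ j).trans hξ)
    rw [abs_le] at h3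
    rw [hre, abs_le]
    have h4 : -|Real.log (a j / 2)| ≤ Real.log (a j / 2) := neg_abs_le _
    have h5 : Real.log (2 * a j) ≤ |Real.log (2 * a j)| := le_abs_self _
    have h6 := hCj j
    have h7 : 0 ≤ |Real.log (2 * a j)| := abs_nonneg _
    have h8 : 0 ≤ |Real.log (a j / 2)| := abs_nonneg _
    change ((Ah j).totalDegree : ℝ) * Real.log m + _ ≤ _ at h1
    change _ ≤ ((Ah j).totalDegree : ℝ) * Real.log m + _ at h2
    constructor <;> simp only [hd] <;> linarith
  -- ### constants for the bounds
  set C₁ : ℝ := (Cb + (∑ i : Fin s, |r i.succ|) * Cb + ‖c‖) / |r 0| with hC₁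
  have hC₁0 : 0 ≤ C₁ := by rw [hC₁]; positivity
  set G : Fin (s + 1) → Polynomial ℂ := Fin.cons Fe (fun i => F i.succ) with hG
  set B : Fin (s + 1) → ℝ := fun j => ∑ i ∈ Finset.range ((G j).natDegree + 1), ‖(G j).coeff i‖ with hB
  have hB0 : ∀ j, 0 ≤ B j := fun j => Finset.sum_nonneg fun _ _ => norm_nonneg _
  -- ### the bound on the unit polydisc
  have hPbound : ∀ᶠ m : ℕ in atTop, ∀ ξ : Fin (s + 1) → ℂ, ‖ξ‖ ≤ 1 →
      ‖P 0 (x₀ m + ξ)‖ ≤ ‖c₀⁻¹‖ * (Real.exp C₁ * (m : ℝ) ^ ν +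
        (if Fe = 0 then 0 else B 0 * Real.exp Cb ^ (1 + Fe.natDegree) *
          (m : ℝ) ^ (((d 0 : ℝ) / e) * (1 + Fe.natDegree)))) ∧
      ∀ i : Fin s, ‖P i.succ (x₀ m + ξ)‖ ≤
        (if F i.succ = 0 then 0 else B i.succ * Real.exp Cb ^ (1 + (F i.succ).natDegree) *
          (m : ℝ) ^ (((d 0 : ℝ) / e) * (1 + (F i.succ).natDegree))) := by
    filter_upwards [hbox, eventually_ge_atTop 1] with m hm hm_one ξ hξ
    have hm1 : (1 : ℝ) ≤ m := by exact_mod_cast hm_one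
    have hm0 : (0 : ℝ) < m := by linarith
    have ht := hm ξ hξ
    set z : Fin (s + 1) → ℂ := x₀ m + ξ with hz
    -- `|u| ≤ e^{Cb} m^{d₀/e}` and `max 1 |u|` likewise
    have hu : ‖exp (z 0 / (e : ℂ))‖ ≤ Real.exp Cb * (m : ℝ) ^ ((d 0 : ℝ) / e) := by
      rw [Complex.norm_exp]
      have hre : (z 0 / (e : ℂ)).re = (z 0).re / e := by
        rw [show (e : ℂ) = ((e : ℝ) : ℂ) by push_cast; rfl, Complex.div_ofReal_re]
      rw [hre]
      have h0 := (abs_le.1 (ht 0)).2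
      calc Real.exp ((z 0).re / e) ≤ Real.exp ((d 0 * Real.log m + Cb) / e) :=
            Real.exp_le_exp.2 (div_le_div_of_nonneg_right (by simp only [hz, Pi.add_apply] at h0 ⊢; linarith) hepos.le)
        _ ≤ Real.exp (Cb + (d 0 / e) * Real.log m) := by
            refine Real.exp_le_exp.2 ?_
            rw [add_div]
            have : Cb / e ≤ Cb := div_le_self hCb0 he1
            have : (d 0 : ℝ) * Real.log m / e = d 0 / e * Real.log m := by ring
            linarith
        _ = Real.exp Cb * (m : ℝ) ^ ((d 0 : ℝ) / e) := by
            rw [Real.exp_add, Real.rpow_def_of_pos hm0, mul_comm (Real.log m)]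
    have hu1 : 1 ≤ Real.exp Cb * (m : ℝ) ^ ((d 0 : ℝ) / e) := by
      have ha1 : (1 : ℝ) ≤ Real.exp Cb := Real.one_le_exp hCb0
      have hb1 : (1 : ℝ) ≤ (m : ℝ) ^ ((d 0 : ℝ) / e) := Real.one_le_rpow hm1 (by positivity)
      nlinarith
    have hmax : max 1 ‖exp (z 0 / (e : ℂ))‖ ≤ Real.exp Cb * (m : ℝ) ^ ((d 0 : ℝ) / e) := max_le hu1 hu
    -- generic bound for `u G(u)`
    have hGb : ∀ G : Polynomial ℂ, ‖exp (z 0 / (e : ℂ)) * G.eval (exp (z 0 / (e : ℂ)))‖ ≤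
        if G = 0 then 0 else (∑ i ∈ Finset.range (G.natDegree + 1), ‖G.coeff i‖) *
          Real.exp Cb ^ (1 + G.natDegree) * (m : ℝ) ^ (((d 0 : ℝ) / e) * (1 + G.natDegree)) := by
      intro G
      split_ifs with hG0
      · rw [hG0, Polynomial.eval_zero, mul_zero, norm_zero]
      · rw [norm_mul]
        have hBG : 0 ≤ ∑ i ∈ Finset.range (G.natDegree + 1), ‖G.coeff i‖ :=
          Finset.sum_nonneg fun _ _ => norm_nonneg _
        have hGe := (norm_eval_le_sum_mul_pow G (exp (z 0 / (e : ℂ)))).trans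
          (mul_le_mul_of_nonneg_left (pow_le_pow_left₀ (zero_le_one.trans (le_max_left _ _)) hmax _) hBG)
        calc ‖exp (z 0 / (e : ℂ))‖ * ‖G.eval (exp (z 0 / (e : ℂ)))‖
            ≤ (Real.exp Cb * (m : ℝ) ^ ((d 0 : ℝ) / e)) *
                ((∑ i ∈ Finset.range (G.natDegree + 1), ‖G.coeff i‖) *
                  (Real.exp Cb * (m : ℝ) ^ ((d 0 : ℝ) / e)) ^ G.natDegree) :=
              mul_le_mul hu hGe (norm_nonneg _) (by positivity)
          _ = (∑ i ∈ Finset.range (G.natDegree + 1), ‖G.coeff i‖) *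
                (Real.exp Cb * (m : ℝ) ^ ((d 0 : ℝ) / e)) ^ (1 + G.natDegree) := by ring
          _ = (∑ i ∈ Finset.range (G.natDegree + 1), ‖G.coeff i‖) * Real.exp Cb ^ (1 + G.natDegree) *
                (m : ℝ) ^ (((d 0 : ℝ) / e) * (1 + G.natDegree)) := by
              rw [mul_pow, ← Real.rpow_natCast ((m : ℝ) ^ ((d 0 : ℝ) / e)), ← Real.rpow_mul hm0.le]
              push_cast
              ring
    constructor
    · -- `P 0`
      have hx0re : (fastBack r c e z 0).re ≤ ν * Real.log m + C₁ := by
        rw [re_fastBack_zero]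
        -- `Re z_j = d_j log m + t_j`, `|t_j| ≤ Cb`
        have ht0 := ht 0
        have hts := fun i : Fin s => ht i.succ
        simp only [hz, Pi.add_apply] at ht0 hts ⊢
        set T : ℝ := ((x₀ m 0 + ξ 0).re / e - ∑ i : Fin s, r i.succ * (x₀ m i.succ + ξ i.succ).re - c.re)
          with hT
        have hνr : ν * r 0 = (d 0 : ℝ) / e - ∑ i : Fin s, r i.succ * (d i.succ : ℝ) := by
          rw [hνdef]; field_simp
        have hsumsplit : ∑ i : Fin s, r i.succ * ((x₀ m i.succ + ξ i.succ).re - d i.succ * Real.log m) =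
            ∑ i : Fin s, r i.succ * (x₀ m i.succ + ξ i.succ).re -
              (∑ i : Fin s, r i.succ * (d i.succ : ℝ)) * Real.log m := by
          rw [Finset.sum_mul, ← Finset.sum_sub_distrib]
          exact Finset.sum_congr rfl fun i _ => by ring
        have hTν : T = ν * r 0 * Real.log m + (((x₀ m 0 + ξ 0).re - d 0 * Real.log m) / e -
            ∑ i : Fin s, r i.succ * ((x₀ m i.succ + ξ i.succ).re - d i.succ * Real.log m) - c.re) := by
          rw [hT, hsumsplit, hνr]
          field_simp
          ring
        have hErr : |((x₀ m 0 + ξ 0).re - d 0 * Real.log m) / e -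
            ∑ i : Fin s, r i.succ * ((x₀ m i.succ + ξ i.succ).re - d i.succ * Real.log m) - c.re| ≤
            Cb + (∑ i : Fin s, |r i.succ|) * Cb + ‖c‖ := by
          refine (abs_sub _ _).trans (add_le_add ((abs_sub _ _).trans (add_le_add ?_ ?_)) (Complex.abs_re_le_norm c))
          · rw [abs_div, abs_of_pos hepos]
            exact (div_le_self (abs_nonneg _) he1).trans ht0
          · refine (Finset.abs_sum_le_sum_abs _ _).trans ?_
            rw [Finset.sum_mul]
            refine Finset.sum_le_sum fun i _ => ?_
            rw [abs_mul]
            exact mul_le_mul_of_nonneg_left (hts i) (abs_nonneg _)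
        -- divide by `r 0`
        have hr0 : 0 < |r 0| := abs_pos.2 hr
        have key : T / r 0 ≤ ν * Real.log m + C₁ := by
          rw [hTν, add_div, show ν * r 0 * Real.log m / r 0 = ν * Real.log m by field_simp]
          gcongr ν * Real.log m + ?_
          rw [hC₁, le_div_iff₀ hr0]
          calc _ * |r 0| ≤ |(((x₀ m 0 + ξ 0).re - d 0 * Real.log m) / e -
                ∑ i : Fin s, r i.succ * ((x₀ m i.succ + ξ i.succ).re - d i.succ * Real.log m) - c.re) / r 0| * |r 0| :=
                mul_le_mul_of_nonneg_right (le_abs_self _) hr0.le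
            _ = |((x₀ m 0 + ξ 0).re - d 0 * Real.log m) / e -
                ∑ i : Fin s, r i.succ * ((x₀ m i.succ + ξ i.succ).re - d i.succ * Real.log m) - c.re| := by
                rw [abs_div, div_mul_cancel₀ _ hr0.ne']
            _ ≤ _ := hErr
        exact key
      rw [hP0, norm_mul]
      refine mul_le_mul_of_nonneg_left ((norm_sub_le _ _).trans (add_le_add ?_ ?_)) (norm_nonneg _)
      · rw [Complex.norm_exp]
        calc Real.exp (fastBack r c e z 0).re ≤ Real.exp (C₁ + ν * Real.log m) :=
              Real.exp_le_exp.2 (by linarith)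
          _ = Real.exp C₁ * (m : ℝ) ^ ν := by rw [Real.exp_add, Real.rpow_def_of_pos hm0, mul_comm (Real.log m)]
      · have h := hGb Fe
        simp only [hB, hG, Fin.cons_zero]
        exact h
    · intro i
      rw [hPs]
      have h := hGb (F i.succ)
      simp only [hB, hG, Fin.cons_succ]
      exact h
  -- ### relative smallness
  have hPsmall : ∀ j, ∀ θ : ℝ, 0 < θ → ∀ᶠ m : ℕ in atTop, ∀ ξ : Fin (s + 1) → ℂ, ‖ξ‖ < 1 →
      ‖P j (x₀ m + ξ)‖ ≤ θ * (m : ℝ) ^ (Ah j).totalDegree := by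
    intro j θ hθ
    refine Fin.cases ?_ (fun i => ?_) j
    · -- the fast coordinate
      have hsecond : ∀ᶠ m : ℕ in atTop,
          ‖c₀⁻¹‖ * (if Fe = 0 then 0 else B 0 * Real.exp Cb ^ (1 + Fe.natDegree) *
            (m : ℝ) ^ (((d 0 : ℝ) / e) * (1 + Fe.natDegree))) ≤ θ / 2 * (m : ℝ) ^ (d 0 : ℝ) := by
        by_cases hFe0 : Fe = 0
        · simp only [hFe0, if_true, mul_zero]
          filter_upwards [eventually_ge_atTop 1] with m hm
          positivity
        · simp only [hFe0, if_false]
          have hμlt : ((d 0 : ℝ) / e) * (1 + Fe.natDegree) < d 0 := by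
            have hf1 : 1 ≤ (F 0).natDegree := by
              by_contra h
              push Not at h
              have h0 : (F 0).natDegree = 0 := by omega
              apply hFe0
              rw [hFe, Polynomial.eq_C_of_natDegree_eq_zero h0, Polynomial.eraseLead_C]
            have hFedeg : Fe.natDegree ≤ (F 0).natDegree - 1 := Polynomial.eraseLead_natDegree_le _
            have hlt : (1 + Fe.natDegree : ℝ) < e := by
              rw [he]
              have : 1 + Fe.natDegree < (F 0).natDegree + 1 := by omega
              exact_mod_cast this
            have hd0' : (0 : ℝ) < d 0 := by exact_mod_cast hd0
            calc (d 0 : ℝ) / e * (1 + Fe.natDegree) < (d 0 : ℝ) / e * e :=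
                  mul_lt_mul_of_pos_left hlt (by positivity)
              _ = d 0 := by field_simp
          have h := eventually_const_mul_rpow_le (‖c₀⁻¹‖ * (B 0 * Real.exp Cb ^ (1 + Fe.natDegree))) hμlt
            (half_pos hθ)
          filter_upwards [h] with m hm
          calc ‖c₀⁻¹‖ * (B 0 * Real.exp Cb ^ (1 + Fe.natDegree) * (m : ℝ) ^ ((d 0 : ℝ) / e * (1 + Fe.natDegree)))
              = ‖c₀⁻¹‖ * (B 0 * Real.exp Cb ^ (1 + Fe.natDegree)) * (m : ℝ) ^ ((d 0 : ℝ) / e * (1 + Fe.natDegree)) := by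
                ring
            _ ≤ θ / 2 * (m : ℝ) ^ (d 0 : ℝ) := hm
      filter_upwards [hPbound, eventually_const_mul_rpow_le (‖c₀⁻¹‖ * Real.exp C₁) hνlt (half_pos hθ),
        hsecond] with m hm hk1 hk2 ξ hξ
      have h := (hm ξ hξ.le).1
      rw [show (Ah 0).totalDegree = d 0 from rfl, ← Real.rpow_natCast]
      calc ‖P 0 (x₀ m + ξ)‖ ≤ ‖c₀⁻¹‖ * (Real.exp C₁ * (m : ℝ) ^ ν +
            (if Fe = 0 then 0 else B 0 * Real.exp Cb ^ (1 + Fe.natDegree) *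
              (m : ℝ) ^ (((d 0 : ℝ) / e) * (1 + Fe.natDegree)))) := h
        _ = ‖c₀⁻¹‖ * Real.exp C₁ * (m : ℝ) ^ ν + ‖c₀⁻¹‖ * (if Fe = 0 then 0 else
              B 0 * Real.exp Cb ^ (1 + Fe.natDegree) * (m : ℝ) ^ (((d 0 : ℝ) / e) * (1 + Fe.natDegree))) := by
            ring
        _ ≤ θ / 2 * (m : ℝ) ^ (d 0 : ℝ) + θ / 2 * (m : ℝ) ^ (d 0 : ℝ) := add_le_add hk1 hk2
        _ = θ * (m : ℝ) ^ ((d 0 : ℕ) : ℝ) := by ring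
    · -- the slow coordinates
      by_cases hFi : F i.succ = 0
      · filter_upwards [hPbound, eventually_ge_atTop 1] with m hm hm1 ξ hξ
        have h := (hm ξ hξ.le).2 i
        simp only [hFi, if_true] at h
        exact h.trans (by positivity)
      · have hμlt : ((d 0 : ℝ) / e) * (1 + (F i.succ).natDegree) < d i.succ := by
          have h := hfast i hFi
          rw [div_mul_eq_mul_div, div_lt_iff₀ hepos]
          calc (d 0 : ℝ) * (1 + (F i.succ).natDegree) = (d 0 : ℝ) * ((F i.succ).natDegree + 1) := by ring
            _ < ((F 0).natDegree + 1) * (d i.succ : ℝ) := h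
            _ = (d i.succ : ℝ) * e := by rw [he]; push_cast; ring
        filter_upwards [hPbound, eventually_const_mul_rpow_le
          (B i.succ * Real.exp Cb ^ (1 + (F i.succ).natDegree)) hμlt hθ] with m hm hk ξ hξ
        have h := (hm ξ hξ.le).2 i
        simp only [hFi, if_false] at h
        rw [show (Ah i.succ).totalDegree = d i.succ from rfl, ← Real.rpow_natCast]
        exact h.trans hk
  -- ### the relative moving-polydisc theorem, and translation back
  have hsol := exists_exp_eq_poly_add_near_latticeCentre_local q Ah hA (fun _ => P)
    (Eventually.of_forall fun m j => (hPdiff j).differentiableOn) (fun j θ hθ => hPsmall j θ hθ)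
  filter_upwards [hsol] with m ⟨z, hz, hsys⟩
  refine ⟨z, hz, fun j => ?_⟩
  have hell : ell r c (fastBack r c e z) = z 0 / (e : ℂ) := ell_fastBack hr c e z
  rw [hell]
  refine Fin.cases ?_ (fun i => ?_) j
  · -- the fast coordinate
    have h := hsys 0
    rw [hP0, show Ah 0 = fastData r c A F 0 from rfl, eval_fastData_zero, ← hc₀def, ← he] at h
    refine exp_eq_of_fast_identity (F 0) ?_
    rw [← he, ← hc₀def, ← hFe, h]
    field_simp
  · -- the slow coordinates
    have h := hsys i.succ
    rw [hPs, show Ah i.succ = fastData r c A F i.succ from rfl, eval_fastData_succ] at h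
    rw [fastBack_succ]
    exact h

end Mixed

end Summit.Schanuel.Schanuel.Theorems

end
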